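import Mathlib
import HarnessLib
import HarnessLib.Audit
import Summits.Parity.Statement
import Literature.NumberTheory.Sieve.GoldbachLinnikDirectSeven
import Literature.NumberTheory.Sieve.MontgomeryVaughan1975DensityProofs
import HarnessLib.Audit.Status.Attr

/-!
Route: LinnikGallagherMV

CLOSED (proved) 2026-08-27T17:57:51Z by planner-parity-ideate-p2-g11-0 — reason: proved:Summit.Parity.GeneralizedHardyLittlewood.Theorems.linnikGallagherMV_linnikGallagherExists_proof — note: Line E (director RULING 16:19:15Z): target LinnikGallagherExists (stmt-Parity-20511, rung F-LGE leaf) CLOSED proved by Summit.Parity.GeneralizedHardyLittlewood.Theorems.linnikGallagherMV_linnikGallagherExists_proof (parity-lgmv-p1); 20514/20515 proved; 20512 PointwiseMajorArcsMV / 20513 GallagherLar. The file is kept as the record of this route; refuted decls are indexed as negative knowledge (`ledger negatives`).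

# Route LinnikGallagherMV — some K works in Linnik's p + q + K powers of two, by
Montgomery–Vaughan's pointwise major arcs and Gallagher's large-deviation lemma

X = the three inputs of Gallagher's 1975 proof of LINNIK'S THEOREM in qualitative form, over the
tree's frame
`GoldbachLinnik.goldbach_linnik_with_of_direct_inputs` (Heath-Brown–Puchta §6, pub-lg7; imported,
never forked):
X = PointwiseMajorArcsMV ∧ GallagherLargeDeviationQual ∧ MeanSquareCrude ∧ Assembly. It suffices to
show X: with
A_N(α) = Σ_(2<p≤N) (log p) e(pα), G_L(α) = Σ_(ν<L) e(2^ν α), L = prLen N, the number r″_K(N) of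
representations
N = p + q + 2^(ν_1) + … + 2^(ν_K) (log-weighted) is ∫₀¹ A_N² G_L^K e(−Nα); PointwiseMajorArcsMV
(Montgomery–Vaughan 1975 §§4–8 at a
FIXED level P = N^(6a), the possible exceptional character handled by Page + Deuring–Heilbronn, all
PROVED in the tree) gives for every
even n ∈ [N/2, N] the major-arc lower bound R_𝔐(n) ≥ c₀𝔖(n)n − κ𝔖(n)N unless p_N | n (p_N → ∞ the
largest prime of the exceptional
conductor) and R_𝔐(n) ≥ −κ𝔖(n)N always, plus |A_N| ≤ N^(1−θ) off 𝔐_N (Vinogradov); the Assembly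
aggregates this along the multiset
n = N − Σ2^(ν_i) (tuples with p_N | n are few by the PROVED Pintz–Ruzsa II Lemma 1
`pintzRuzsa_lemma_one`; 𝔖(n) ≥ 2C₀) to
hMaj with M = c₀C₀/4, takes λ < 1 at c = 1 − θ/2 from GallagherLargeDeviationQual (Gallagher's
Lemma: |{α : |G_L(α)| ≥ λL}| ≤ 2^(−cL)),
C from MeanSquareCrude (∫₀¹|A_N G_L|² ≤ (C+ε)·2N L², pair sieve), and K with C·λ^(K−2) < M; the
frame returns `goldbach_linnik_with K`,
i.e. the rung leaf `LinnikGallagherExists` = ∃ K, goldbach_linnik_with K (D-0061 rung «F-LG∃» of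
Parity, FRONTIER floor rung of the
F-P1 family, cell parity-ideate seat p2, director-frontier ruling 2026-08-27T11:29:24Z; target item
rank 0, to be registered as an
ALT-CLOSER; honesty label: formalisation-first of Linnik 1953 / Gallagher 1975 by an internal
assembly over the tree's proved
Montgomery–Vaughan major arcs — no new mathematics, no K value, never distance-to-Goldbach, never
summit credit).
Lean: `Summit.Parity.GeneralizedHardyLittlewood.Theses.LinnikGallagherMV.PointwiseMajorArcsMV ∧
Summit.Parity.GeneralizedHardyLittlewood.Theses.LinnikGallagherMV.GallagherLargeDeviationQual ∧
Summit.Parity.GeneralizedHardyLittlewood.Theses.LinnikGallagherMV.MeanSquareCrude ∧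
Summit.Parity.GeneralizedHardyLittlewood.Theses.LinnikGallagherMV.Assembly`

## Assembly
From PointwiseMajorArcsMV take c₀, then κ := c₀/4, θ, 𝔐, p; put L := prLen N (tree
`GoldbachLinnik.prLen`, K·2^L ≤ N eventually by
`eventually_mul_two_pow_prLen_le`, 1 ≤ L by `eventually_le_prLen`), expand `majorArcDirectIntegral
(𝔐 N) N L K = Σ_ν R_𝔐(N − Σ2^(ν_i))`
(`GoldbachLinnik.majorArcDirectIntegral_eq_sum`); every n_ν = N − Σ2^(ν_i) is even with N/2 ≤ n_ν ≤
N; on tuples with p_N ∤ n_ν use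
R_𝔐 ≥ (c₀/2 − κ)𝔖(n_ν)N ≥ (c₀/4)·2C₀·N (𝔖(n) ≥ 2C₀ for even n, tree `SingularSeries`), on the others
R_𝔐 ≥ −κ𝔖(n_ν)N and
Σ_(bad ν) 𝔖(n_ν) ≤ η L^K (PROVED `pintzRuzsa_lemma_one` with d = p_N ≥ Q(η), summed over ν_2, …,
ν_K; no bad tuples when p_N = 0),
whence hMaj with M = c₀C₀/4 (all ε); hS with U_N = N^(1−θ); from GallagherLargeDeviationQual at c :=
1 − θ/2 take λ (w.l.o.g. λ ≥ 0) and
E_N := {α : λ·L ≤ |G_L(α)|} (closed, measurable), so hG holds off E_N and hEU reads 2^(−cL)·N^(2−2θ)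
≤ εN, true since
2^(−L) ≤ 2^(1+√(log₂N+1))/N; hCi from MeanSquareCrude by monotonicity of the set integral; choose K
≥ 2 with C·λ^(K−2) < M (λ < 1) and
apply `GoldbachLinnik.goldbach_linnik_with_of_direct_inputs`: `goldbach_linnik_with K`, hence ∃ K.
The deciding theorem `closes` applies the
Assembly item to the two cruxes and the support (all four items in its cone).

CLOSES_TARGET: closes rung F-LGE of Parity: Summit.Parity.GeneralizedHardyLittlewood.Theses.LinnikGallagherMV.LinnikGallagherExists (D-0061; not the summit Statement) — the deciding theorem of this route concludes that registered leaf instead of the Statement decl `GeneralizedHardyLittlewood` (class rung: servable and labelled, never counted as concluding the summit Statement).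

Rationale: WHY THIS LINE. Linnik (Linnik1953) and Gallagher (Gallagher1975, Theorem 1) proved that every large
even N is p + q + at most K powers of two for SOME K;
every later paper (K = 54000, 770, 200, 13 HeathbrownPuchta2002, 8 PintzRuzsa2020) optimises K, and
the tree holds the K-machinery
(pub-lg7's direct frame, Pintz–Ruzsa large-deviation certificates for λ at c = 3/5, Romanov's lemma,
PR II Lemma 1 `pintzRuzsa_lemma_one`,
the pair-sieve mean square) but NO sorry-free `goldbach_linnik_with K` for any K: the named facts
`goldbach_linnik` (K = 8) and pub-lg7's
K = 7 line import Pintz–Ruzsa I Theorem 2 / numerical constants that are not in the tree. The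
observation of this line is that the
qualitative theorem needs none of them: Montgomery–Vaughan's exceptional-set paper
(MontgomeryVaughanActa1975 §§4–8), typed and PROVED in the
tree through `MontgomeryVaughan1975.majorArc_formulae_holds`, `section6_formulae_holds`,
`lemma43_gallagher_holds`, `exists_exceptionalZero_unique`
and `abs_excRatio_le`, already contains a POINTWISE major-arc formula at power level with the
exceptional character built in, whose only
defect — the factor (1 + excRatio χ n), possibly near 0 — is confined to the multiples of the
largest prime of the exceptional conductor,
a set the power-of-two multiset cannot concentrate on (PR II Lemma 1, proved); and Gallagher's
large-deviation lemma for G_L in the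
qualitative form ∀ c < 1 ∃ λ < 1 follows from the tree's Chernoff frame
`PintzRuzsa2003.measureReal_norm_powTwoExpSum_ge_le` once the
moment bound E[e^(ξ·S_L)] ≤ e^(ξL)((1+e^(−ξ))/2)^L (binary digit changes of ⌊2^L α⌋ are i.i.d. fair
bits) is proved for all ξ. Imported
area: multiplicative number theory (zero-density, Deuring–Heilbronn) via MV 1975 — already in the
tree; nothing from outside it. What the
line does that the existing Parity routes do not: it is the only route whose leaf is a statement of
Linnik type (GoldbachHeathBrownDispersion
and RomanoffHeathBrown concern p + π with π a Heath-Brown prime; RealCharacterTwist,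
BilinearLiouvillePhase, IllusoryCubeCorner are
correlation / sieve routes); no entry of the negatives index concerns the circle method.

RANKED CRUXES. #0 LinnikGallagherExists (target) — for some K every sufficiently large even N is p +
q + 2^(e_1) + … + 2^(e_k) with p, q prime and k ≤ K (Linnik 1953; Gallagher 1975 Theorem 1). (why it
might fail: it is a published theorem (Linnik 1953, Gallagher 1975; K = 8 by Pintz–Ruzsa 2020); the
only risk is formal: the MV major arcs might not aggregate along the power-of-two multiset with the
constants the frame needs (then: larger K, same statement).) [Linnik1953, Gallagher1975,
PintzRuzsa2020, HeathbrownPuchta2002]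
#2 PointwiseMajorArcsMV (crux) — POINTWISE MAJOR ARCS WITH THE EXCEPTIONAL PRIME BUILT IN: there is
c₀ > 0 such that for every κ > 0 there are θ > 0, measurable sets 𝔐_N ⊂ ℝ and p_N ∈ {0} ∪ {odd
primes} with p_N = 0 or p_N → ∞, such that eventually in N: |A_N(α)| ≤ N^(1−θ) for α ∈ [0,1] ∖ 𝔐_N,
and for every even n with N/2 ≤ n ≤ N, R_𝔐(n) := Re ∫_([0,1]∩𝔐_N) A_N² e(−nα) ≥ −κ𝔖(n)N, and R_𝔐(n)
≥ c₀𝔖(n)n − κ𝔖(n)N whenever p_N ∤ n (Montgomery–Vaughan 1975 (4.3)–(4.6), (7.1)–(7.4), §8 at the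
level P = N^(6a), a ∈ {δ/4, 2δ/3, δ} chosen by the size of the unique exceptional conductor; p_N =
its largest prime factor). [difficulty: L] (why it might fail: MV's formulae carry the gcd term
X^(1+δ)P⁻¹·(n, r̃), fatal when the exceptional conductor r̃ exceeds P^(1/6) and (n, r̃) is large:
the three-level selection (a ∈ {δ/4, 2δ/3, δ}, Page at T = N^(6δ)) must dodge it for EVERY n, and c₁
must be uniform across levels.) [MontgomeryVaughanActa1975, Gallagher1975, MontgomeryVaughan2007]
#3 GallagherLargeDeviationQual (crux) — GALLAGHER'S LARGE-DEVIATION LEMMA, qualitative: for every c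
< 1 there are λ < 1 and L₀ with |{α ∈ [0,1] : |G_L(α)| ≥ λL}| ≤ 2^(−cL) for all L ≥ L₀, G_L(α) =
Σ_(ν<L) e(2^ν α) (Gallagher 1975 Lemma 1 in the c-form of Heath-Brown–Puchta Lemma 1 / Pintz–Ruzsa I
Theorem 3; via the moment bound E[exp(ξ·#{digit changes})] ≤ ((1+e^ξ)/2)^L for all ξ and the tree's
Chernoff frame). [difficulty: M] (why it might fail: near α = 0 the set has measure ≥
(1−λ)L·2^(−L)/(4π), so c → 1 forces λ → 1 and L₀ → ∞ together — a statement with L₀ independent of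
c, or with c = 1, is false; the typed order of quantifiers (λ, L₀ after c) is exactly what survives.
STATUS: proved beneath in Literature — `PintzRuzsa2003.gallagherLargeDeviationQual`, p532468,
2026-08-27.) [Gallagher1975, HeathbrownPuchta2002, PintzRuzsa2003]
#9 MeanSquareCrude (support) — CRUDE MEAN SQUARE on the whole circle: there is C > 0 with ∫₀¹
|A_N(α) G_L(α)|² dα ≤ (C + ε)·2N L² eventually, for L = prLen N and every ε > 0 (Parseval: the
integral is Σ_(ν,μ<L) Σ_(p−p′=2^ν−2^μ) log p log p′ ≤ L·θ(N) log N + L²·sup_h r_pairs(N, h) — the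
pair sieve `primePairs_card_le` uniform in the shift with the h/φ(h) factor bounded on differences
of powers of two by Romanov's lemma, tree `GoldbachLinnik.PairSieveBound` machinery). [difficulty:
M] [PintzRuzsa2003, HeathbrownPuchta2002, Nathanson1996]

TWO-LAYER PLAN. PointwiseMajorArcsMV ⇐ LevelSelection (Page's theorem
`exists_exceptionalZero_unique` at T = N^(6δ) with 4c₁ ≤ c_Page: for X ≥ X₀ some
a ∈ {δ/4, 2δ/3, δ} has every (c₁, X^(6a))-exceptional conductor ≤ (X^(6a))^(2/3)) →
MajorArcFormulaeAtSmall (MV (4.3)–(4.6) + (7.1)–(7.4) for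
EVERY small c₁, a copy-with-parameter of the proved `majorArc_formulae_of_lemma43_gallagher` ∘
`section6_formulae_holds c₁`) →
ExceptionalConductorUnbounded (Siegel for each fixed modulus,
`DirichletCharacter.Lfunction_ne_zero_of_re_eq_one`-type facts: exceptional
conductors at level P → ∞ exceed any R) → PointwiseMajorArcsMV; GallagherLargeDeviationQual ⇐ G3core
(∀ ξ ≥ 0 ∀ L: `PintzRuzsa2003.expMoment ξ L
≤ e^(ξL)((1+e^(−ξ))/2)^L`) → GallagherLargeDeviationQual (tree Chernoff frame
`measureReal_norm_powTwoExpSum_ge_le` + `powSum_eq_powTwoExpSum`,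
optimise ξ) — both registered as BC3 birth skeletons (bc/*_birth.lean, kernel-checked compositions);
filed by split once a prover claims the parent.

KILL CRITERIA. No refutation of an item kills the MECHANISM (Linnik's theorem is true and this is
its classical proof): a refutation of PointwiseMajorArcsMV
as typed means the n-range [N/2, N], the 𝔖(n)N-normalisation of the error or the "p_N ∤ n" exemption
is mis-cut (class misstated ⇒ restate:
e.g. exempt n with (n, r̃_N) > N^(δ/7) instead of p_N | n, still PR-Lemma-1-summable); a refutation
of GallagherLargeDeviationQual as typed can
only be a quantifier slip (repair in place). The route is closed superseded the moment any
sorry-free `goldbach_linnik_with K` lands in the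
tree (pub-lg7's K = 7 line or a typed Pintz–Ruzsa K = 8), and is pointless if the director declines
to register the leaf as rung «F-LG∃»
(then: close not-a-thesis, keep PointwiseMajorArcsMV / GallagherLargeDeviationQual as supports
offered to pub-lg7).

NOT DECOMPOSED YET. The level selection, the uniform-in-c₁ major-arc formulae, the unboundedness of
exceptional conductors, the moment bound G3core, the
periodisation of MV's arcs (⊂ [Q⁻¹, 1+Q⁻¹]) into [0,1], the passage from MV's S (primes in (P^(7/6),
X]) to A_N (all odd primes, difference
≤ θ(P^(7/6)) ≪ N^(1−θ)), the bound Ĩ(n) ≤ n for the exceptional pair sum and n/φ(n) ≤ 𝔖(n)/C₀ are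
layer-2 children (Two-layer plan / BC3
skeletons) or prover-level lemmas; all constants (c₀, θ, λ, C, K) are deliberately existential
(typing checklist 4c(iv)) — in particular NO
value of K is claimed anywhere.

CHEAPEST FALSIFIER. (1) Quantifier sanity of GallagherLargeDeviationQual at the edge: the measure of
{|G_L| ≥ λL} is ≥ (1−λ)L2^(−L)/(4π) (Taylor at α = 0), so the
typed "∀ c < 1 ∃ λ < 1 ∃ L₀" is the strongest true form — checked by hand (c = 1 would be refutable;
not claimed). (2) The in-house certificates
`PintzRuzsa2003.largeDevSet_measure_le_0789401` (λ = 0.789401 at exponent c = 3/5, Pintz–Ruzsa I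
Cor. 2 kernel-certified) and
`PintzRuzsa2003.largeDevSet_measure_le_07163436` (λ = 0.7163436 at c = 1/2), both in
`Literature/NumberTheory/Sieve/PowTwoRieszProductCertificate.lean`,
are instances consistent with the crux; and since 2026-08-27T12:55Z the crux ITSELF is PROVED
verbatim in Literature as
`PintzRuzsa2003.gallagherLargeDeviationQual`
(`Literature/NumberTheory/Sieve/PowTwoExpSumLargeDeviationQual.lean`, parity-lit g15, p532468):
item GallagherLargeDeviationQual closes by a one-line Theorems file once the route is OPEN. (3)
PointwiseMajorArcsMV at 𝔐_N = [0,1]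
(allowed, the minor-arc clause then being vacuous) reads r(n) ≥ (c₀ − 2κ)𝔖(n)n for all large even n
∤ p_N — binary-Goldbach strength, so the
crux is NOT cheaply closable and a refuter cannot kill it by a junk witness either; the BC2/BC7
probes confirm (all cheap closings fail, no
vacuity). (4) Gcd bookkeeping of the level selection (ROUND-5 memo §2′): q ≤ X^δ ⇒ a = δ/4, gcd term
≤ X^(1−δ/2); X^δ < q ≤ X^(4δ) ⇒ a = δ, no
datum; q > X^(4δ) ⇒ a = 2δ/3, no datum — margin X^(δ/2) in the only case with a datum. No kit job
needed (work-bound line).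

NUMBERS. K: 8 (PintzRuzsa2020), 13 (HeathbrownPuchta2002), 7 conditional / in progress (pub-lg7);
this route claims none. Large deviations: the tree
certifies λ = 0.789401 at c = 3/5 (`PintzRuzsa2003.largeDevSet_measure_le_0789401`, also
`prLen_largeDevSetL_measure_le_0789401` at
Pintz–Ruzsa's length) and λ = 0.7163436 at c = 1/2
(`PintzRuzsa2003.largeDevSet_measure_le_07163436`); Heath-Brown–Puchta use λ = 0.863665 at
c = 109/154; the route needs only ∃ λ < 1 for each c < 1, now a tree theorem
(`PintzRuzsa2003.gallagherLargeDeviationQual`). MV level: P = X^(6δ), Q = X^(1−6δ), δ ≤ δ₀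
(MontgomeryVaughanActa1975 §4), exceptional set ≪ X^(1−δ) (not used here).

DEFINITION REQUESTS. None: every notion is in the tree (`goldbach_linnik_with`,
`GoldbachLinnik.oddPrimeLogSum`, `powSumL`, `prLen`, `majorArcGoldbachIntegral`,
`majorArcDirectIntegral`, `goldbachSingularSeries`, `MontgomeryVaughan1975.IsExceptionalZero`,
`excRatio`, `PintzRuzsa2003.expMoment`).

Novelty: HONESTY LABEL (director-frontier 2026-08-27T11:29:24Z, verbatim): «formalisation-first of Linnik
1951 / Gallagher 1975 by an internal assembly
over the tree's proved Montgomery–Vaughan major arcs; no new mathematics, no K value, never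
distance-to-Goldbach» (Linnik's unconditional
paper is Linnik1953; the 1951 one assumes GRH).
Searches (2026-08-27): `lit search "Gallagher primes powers of 2"` / `"Linnik powers of two
Goldbach"` (corpus fts: hits [corpus:paper:arxiv-math_0201299 p.5–8]
= Heath-Brown–Puchta §§4–6, [corpus:paper:pintz2020 p.25] = Pintz–Ruzsa II bibliography; Gallagher
1975 itself not held → `lit want` acq-03196, cite-only);
`lit galaxy search "powers of two|Linnik-Gallagher|Gallagher's lemma" --star all` (0 relevant: web
noise); `lean search 'goldbach_linnik_with'` (tree:
`goldbach_linnik_with`, `_mono`, `goldbach_linnik_iff_with_eight`, pub-lg7's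
`goldbach_linnik_seven_of_direct_inputs`, `goldbach_linnik_with_of_direct_inputs`
— no sorry-free instance for any K); `lean search 'majorArc_formulae'` (MV §§4–8 proved:
`majorArc_formulae_holds`, `majorArc_lowerBound_holds`).
Nearest prior art found: Gallagher1975 (Theorem 1 and Lemma 1: exactly this proof, on paper);
HeathbrownPuchta2002 §6 [corpus:paper:arxiv-math_0201299 p.8]
(the frame, typed by pub-lg7); MontgomeryVaughanActa1975 §§4–8 (the major arcs, typed and proved in
the tree for the exceptional-set theorem, never
yet pointed at Linnik's problem inside the tree).
Delta: none mathematically (grade known, by  [refs: paper:arxiv-math_0201299, paper:pintz2020, Linnik1953, Gallagher1975, HeathbrownPuchta2002, MontgomeryVaughanActa1975, PintzRuzsa2003]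

Barriers (technique_class: circle-method, exceptional-zero, large-deviation): - technique_class: circle-method, exceptional-zero, large-deviation
- Literature.Barriers.Parity.CircleMethodBinaryBarrier: outside — the problem is not binary: the K
free powers of two are a third variable whose large deviations are exponentially rare
(GallagherLargeDeviationQual), so the minor arcs are bounded through ∫|A G|² · (λL)^(K−2) against
the main term M·N·L^K (Cλ^(K−2) < M), never "in absolute value against a binary main term";
PointwiseMajorArcsMV is a MAJOR-arc statement plus a Vinogradov sup bound used only inside that
Cauchy–Schwarz.
- Literature.Barriers.Parity.SiegelZeroTwinPrimes: outside — the possible exceptional zero is not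
assumed away but carried explicitly (MV §§6–8: the term excRatio·Ĩ(n), Deuring–Heilbronn via
`lemma43_gallagher_holds`, Page via `exists_exceptionalZero_unique`), and its only damage is
confined to p_N | n, which the crux exempts.
- Literature.Barriers.Parity.GoldbachAverageZeros: outside — no power saving in any Goldbach average
and no exceptional-set exponent is claimed; the major-arc lower bound has error κ𝔖(n)N with κ fixed
but arbitrary, and the conclusion is qualitative (∃ K).
- Literature.Barriers.Parity.GoldbachAverageZerosNarrow: outside — nothing of the form
`PowerSavingGoldbachAverage δ` is concluded or implied: the major-arc lower bound has error κ𝔖(n)N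
with κ > 0 fixed-but-arbitrary (an o(1)-type loss, no N^(−δ)), the level P = N^(6a) saving appears
only inside MV's proved formulae, and the conclusion ∃K is qualitative; in

History (route lifecycle, newest last):
- 2026-08-27T12:42:33Z · closes_target -> closes rung F-LGE of Parity: Summit.Parity.GeneralizedHardyLittlewood.Theses.LinnikGallagherMV.LinnikGallagherExists (D-0061; not the summit Statement) (planner-parity-ideate-p2-g9-0)
- 2026-08-27T17:57:51Z · CLOSED proved — proved:Summit.Parity.GeneralizedHardyLittlewood.Theorems.linnikGallagherMV_linnikGallagherExists_proof (planner-parity-ideate-p2-g11-0)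

sub-problem: GeneralizedHardyLittlewood · status: closed(proved) · opened planner-parity-ideate-p2-g9-0 2026-08-27T12:15:45Z · rev 6 · ledger route-Parity-LinnikGallagherMV
GENERATED by the gate from the ledger (D-0016/17). Provers cite these decls: `theorem foo : Summit.Parity.GeneralizedHardyLittlewood.Theses.LinnikGallagherMV.<Decl> := …` in Summits/Parity/GeneralizedHardyLittlewood/Theorems/<Name>.lean.
-/

namespace Summit.Parity.GeneralizedHardyLittlewood.Theses.LinnikGallagherMV

open scoped BigOperators Topology Manifold Classical MeasureTheory ProbabilityTheory Matrix InnerProductSpace ComplexConjugate ContinuousMap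
open Filter Set Function TopologicalSpace MeasureTheory

attribute [summit_statement] _root_.GeneralizedHardyLittlewood
-- H21.Audit: the closer leaf Summit.Parity.GeneralizedHardyLittlewood.Theses.LinnikGallagherMV.LinnikGallagherExists is an item decl of this route file — tagged summit_statement below, after its declaration

/-- item stmt-Parity-20511 · target · rank 0 · closed · proved by Summit.Parity.GeneralizedHardyLittlewood.Theorems.linnikGallagherMV_linnikGallagherExists_proof (prover) · by planner
why it might fail: it is a published theorem (Linnik 1953, Gallagher 1975; K = 8 by Pintz–Ruzsa 2020); the only risk is formal: the MV major arcs might not aggregate along the power-of-two multiset with the constants the frame needs (then: larger K, same statement).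
sources: Linnik1953, Gallagher1975, PintzRuzsa2020, HeathbrownPuchta2002
[target] for some K every sufficiently large even N is p + q + 2^(e_1) + … + 2^(e_k) with p, q prime
and k ≤ K (Linnik 1953; Gallagher 1975 Theorem 1). -/
@[route_item "route-Parity-LinnikGallagherMV"]
def LinnikGallagherExists : Prop :=
  ∃ K : ℕ, Literature.NumberTheory.Sieve.goldbach_linnik_with K

-- `LinnikGallagherExists` holds: proved by `Summit.Parity.GeneralizedHardyLittlewood.Theorems.linnikGallagherMV_linnikGallagherExists_proof` (its module imports this route file, so no `_holds` link can be stated here).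

/-- item stmt-Parity-20512 · crux · rank 2 · closed · proved by Summit.Parity.GeneralizedHardyLittlewood.Theorems.linnikGallagherMV_pointwiseMajorArcsMV_proof (prover) · by planner
why it might fail: MV's formulae carry the gcd term X^(1+δ)P⁻¹·(n, r̃), fatal when the exceptional conductor r̃ exceeds P^(1/6) and (n, r̃) is large: the three-level selection (a ∈ {δ/4, 2δ/3, δ}, Page at T = N^(6δ)) must dodge it for EVERY n, and c₁ must be uniform across levels.
sources: MontgomeryVaughanActa1975, Gallagher1975, MontgomeryVaughan2007
[crux] POINTWISE MAJOR ARCS WITH THE EXCEPTIONAL PRIME BUILT IN: there is c₀ > 0 such that for every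
κ > 0 there are θ > 0, measurable sets 𝔐_N ⊂ ℝ and p_N ∈ {0} ∪ {odd primes} with p_N = 0 or p_N → ∞,
such that eventually in N: |A_N(α)| ≤ N^(1−θ) for α ∈ [0,1] ∖ 𝔐_N, and for every even n with N/2 ≤ n
≤ N, R_𝔐(n) := Re ∫_([0,1]∩𝔐_N) A_N² e(−nα) ≥ −κ𝔖(n)N, and R_𝔐(n) ≥ c₀𝔖(n)n − κ𝔖(n)N whenever p_N ∤
n (Montgomery–Vaughan 1975 (4.3)–(4.6), (7.1)–(7.4), §8 at the level P = N^(6a), a ∈ {δ/4, 2δ/3, δ}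
chosen by the size of the unique exceptional conductor; p_N = its largest prime factor).
[difficulty: L] -/
@[route_item "route-Parity-LinnikGallagherMV", crux]
def PointwiseMajorArcsMV : Prop :=
  ∃ c₀ : ℝ, 0 < c₀ ∧ ∀ κ : ℝ, 0 < κ → ∃ θ : ℝ, 0 < θ ∧ ∃ 𝔐 : ℕ → Set ℝ, (∀ N, MeasurableSet (𝔐 N)) ∧ ∃ p : ℕ → ℕ, (∀ N, p N = 0 ∨ ((p N).Prime ∧ Odd (p N))) ∧ (∀ B : ℕ, ∀ᶠ N : ℕ in atTop, p N = 0 ∨ B ≤ p N) ∧ (∀ᶠ N : ℕ in atTop, ∀ α ∈ Set.Icc (0 : ℝ) 1 \ 𝔐 N, ‖Literature.NumberTheory.Sieve.GoldbachLinnik.oddPrimeLogSum N α‖ ≤ (N : ℝ) ^ (1 - θ)) ∧ (∀ᶠ N : ℕ in atTop, ∀ n : ℕ, Even n → N ≤ 2 * n → n ≤ N → -(κ * (Literature.NumberTheory.Sieve.goldbachSingularSeries n * N)) ≤ Literature.NumberTheory.Sieve.GoldbachLinnik.majorArcGoldbachIntegral (𝔐 N) N n ∧ (¬ (p N ∣ n)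 → c₀ * (Literature.NumberTheory.Sieve.goldbachSingularSeries n * n) - κ * (Literature.NumberTheory.Sieve.goldbachSingularSeries n * N) ≤ Literature.NumberTheory.Sieve.GoldbachLinnik.majorArcGoldbachIntegral (𝔐 N) N n))

-- `PointwiseMajorArcsMV` holds: proved by `Summit.Parity.GeneralizedHardyLittlewood.Theorems.linnikGallagherMV_pointwiseMajorArcsMV_proof` (its module imports this route file, so no `_holds` link can be stated here).

/-- item stmt-Parity-20513 · crux · rank 3 · closed · proved by Summit.Parity.GeneralizedHardyLittlewood.Theorems.linnikGallagherMV_gallagherLargeDeviationQual_proof (prover) · by planner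
why it might fail: near α = 0 the set has measure ≥ (1−λ)L·2^(−L)/(4π), so c → 1 forces λ → 1 and L₀ → ∞ together — a statement with L₀ independent of c, or with c = 1, is false; the typed order of quantifiers (λ, L₀ after c) is exactly what survives.
sources: Gallagher1975, HeathbrownPuchta2002, PintzRuzsa2003
[crux] GALLAGHER'S LARGE-DEVIATION LEMMA, qualitative: for every c < 1 there are λ < 1 and L₀ with
|{α ∈ [0,1] : |G_L(α)| ≥ λL}| ≤ 2^(−cL) for all L ≥ L₀, G_L(α) = Σ_(ν<L) e(2^ν α) (Gallagher 1975
Lemma 1 in the c-form of Heath-Brown–Puchta Lemma 1 / Pintz–Ruzsa I Theorem 3; via the moment bound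
E[exp(ξ·#{digit changes})] ≤ ((1+e^ξ)/2)^L for all ξ and the tree's Chernoff frame). [difficulty: M] -/
@[route_item "route-Parity-LinnikGallagherMV", crux]
def GallagherLargeDeviationQual : Prop :=
  ∀ c : ℝ, c < 1 → ∃ lam : ℝ, lam < 1 ∧ ∃ L₀ : ℕ, ∀ L : ℕ, L₀ ≤ L → volume.real {α : ℝ | α ∈ Set.Icc (0 : ℝ) 1 ∧ lam * L ≤ ‖Literature.NumberTheory.Sieve.GoldbachLinnik.powSumL L α‖} ≤ (2 : ℝ) ^ (-(c * L))

-- `GallagherLargeDeviationQual` holds: proved by `Summit.Parity.GeneralizedHardyLittlewood.Theorems.linnikGallagherMV_gallagherLargeDeviationQual_proof` (its module imports this route file, so no `_holds` link can be stated here).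

/-- item stmt-Parity-20514 · support · rank 9 · closed · proved by Summit.Parity.GeneralizedHardyLittlewood.Theorems.linnikGallagherMV_meanSquareCrude_proof (prover) · by planner
sources: PintzRuzsa2003, HeathbrownPuchta2002, Nathanson1996
[support] CRUDE MEAN SQUARE on the whole circle: there is C > 0 with ∫₀¹ |A_N(α) G_L(α)|² dα ≤ (C +
ε)·2N L² eventually, for L = prLen N and every ε > 0 (Parseval: the integral is Σ_(ν,μ<L)
Σ_(p−p′=2^ν−2^μ) log p log p′ ≤ L·θ(N) log N + L²·sup_h r_pairs(N, h) — the pair sieve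
`primePairs_card_le` uniform in the shift with the h/φ(h) factor bounded on differences of powers of
two by Romanov's lemma, tree `GoldbachLinnik.PairSieveBound` machinery). [difficulty: M] -/
@[route_item "route-Parity-LinnikGallagherMV", crux]
def MeanSquareCrude : Prop :=
  ∃ C : ℝ, 0 < C ∧ ∀ ε : ℝ, 0 < ε → ∀ᶠ N : ℕ in atTop, ∫ α in Set.Icc (0 : ℝ) 1, ‖Literature.NumberTheory.Sieve.GoldbachLinnik.oddPrimeLogSum N α * Literature.NumberTheory.Sieve.GoldbachLinnik.powSumL (Literature.NumberTheory.Sieve.GoldbachLinnik.prLen N) α‖ ^ 2 ≤ (C + ε) * (2 * N * (Literature.NumberTheory.Sieve.GoldbachLinnik.prLen N : ℝ) ^ 2)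

-- `MeanSquareCrude` holds: proved by `Summit.Parity.GeneralizedHardyLittlewood.Theorems.linnikGallagherMV_meanSquareCrude_proof` (its module imports this route file, so no `_holds` link can be stated here).

/-- item stmt-Parity-20515 · assembly · rank 1 · closed · proved by Summit.Parity.GeneralizedHardyLittlewood.Theorems.linnikGallagherMV_assembly_proof (prover) · by planner
sources: Gallagher1975, HeathbrownPuchta2002, PintzRuzsa2003
[assembly] PointwiseMajorArcsMV → GallagherLargeDeviationQual → MeanSquareCrude →
LinnikGallagherExists (the aggregation-and-frame step just described; kind assembly, an M-sized item
served to provers — pub-lg7's `goldbach_linnik_seven_of_direct_inputs` and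
`direct_majorArcs_of_pointwise` (GoldbachLinnikDirectSeven.lean) are the templates). -/
@[route_item "route-Parity-LinnikGallagherMV", crux]
def Assembly : Prop :=
  PointwiseMajorArcsMV → GallagherLargeDeviationQual → MeanSquareCrude → LinnikGallagherExists

-- `Assembly` holds: proved by `Summit.Parity.GeneralizedHardyLittlewood.Theorems.linnikGallagherMV_assembly_proof` (its module imports this route file, so no `_holds` link can be stated here).

attribute [summit_statement] _root_.Summit.Parity.GeneralizedHardyLittlewood.Theses.LinnikGallagherMV.LinnikGallagherExists

/-! D-0027 §2.1 — DECIDING THEOREM (planner-authored via `route open/edit --closes-file`; by planner-parity-ideate-p2-g10-0 2026-08-27T16:00:19Z) — ARCHIVED: route closed (proved) 2026-08-27T17:57:51Z; kept so importers keep building: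
its hypotheses are this route's items and its conclusion the registered leaf `Summit.Parity.GeneralizedHardyLittlewood.Theses.LinnikGallagherMV.LinnikGallagherExists` (rung F-LGE, D-0061) (glue_lint), and it elaborates with this file. -/

/-! D-0027 §2.1 deciding theorem of route LinnikGallagherMV (D-0061 option (i): the conclusion is the route's own rank-0
target item `LinnikGallagherExists` = `∃ K, Literature.NumberTheory.Sieve.goldbach_linnik_with K`, to be registered as the
ALT-CLOSER rung leaf «F-LG∃» of Parity/GeneralizedHardyLittlewood — a floor rung of the F-P1 family on the FRONTIER ledger;
honesty label: formalisation-first of Linnik 1951 / Gallagher 1975, never distance to Goldbach).  The Assembly item (M-sized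
glue: aggregate the pointwise major arcs along the power-of-two multiset with Pintz–Ruzsa II Lemma 1, choose c = 1 − θ/2, λ, K
with C·λ^(K−2) < M, and feed pub-lg7's `GoldbachLinnik.goldbach_linnik_with_of_direct_inputs`) is applied to the two cruxes
and the mean-square support; every item is in the cone. -/
@[closes "route-Parity-LinnikGallagherMV"] theorem closes (hA : Assembly) (h₁ : PointwiseMajorArcsMV) (h₂ : GallagherLargeDeviationQual)
    (h₃ : MeanSquareCrude) : LinnikGallagherExists :=
  hA h₁ h₂ h₃

end Summit.Parity.GeneralizedHardyLittlewood.Theses.LinnikGallagherMV
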